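import Summits.ValiantsHypothesis.ValiantsHypothesis.Theorems.LacunarySymmetroidMatrixDescartesPivotTwoDirectionsEnds

/-!
# `MatrixDescartes` census — two-direction pencils at `m = 2`: the POSITIVE-SUPPORT COUNT WITH ENDS
# (`Z₊ ≤ 2·#(supp f + supp g) − [both directions below the pivot] − [both directions above]`, every exponent configuration;
#  a LONE FULL-RANK LETTER against parallel null letters has `Z₊ ≤ 2K − 1` for every `K`)

HONEST FRAMING.  Object-search cell `pub-symmetroid`, Conjecture-B column in PIVOT currency (`…CensusPivotDefs.lean`, seat
conjb-1), seat `val-sym-mdr-p2` (generation 25); helper file `--supports` the crux item stmt-ValiantsHypothesis-18050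
(`Theses.LacunarySymmetroid.MatrixDescartes`, OPEN, on HOLD) with NO closure claim.  Companion of `…PivotTwoDirections`
(val-sym-mdr-p1 g12: `Z₊ ≤ 2·K_u·K_v`, positive-support Descartes) and `…PivotTwoDirectionsEnds` (g13: sign-separated pencils,
negative-support Descartes with both ends).  Here the POSITIVE-support count is given its two ends, with NO sign separation
(the two direction posynomials `f`, `g` may carry any degrees, shared degrees included — a shared degree is a rank-two letter
`X^p (α uuᵀ + β vvᵀ)`, so the COMMUTING-LETTER (simultaneously diagonal) sector of the `(2,K)` rows is covered):

SETTING (`TwoDirections.det_twoDir`).  `Φ = X^{2e}·dJ + X^e f·mu + X^e g·mv + f g·D2` is the determinant of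
`X^e J + f·uuᵀ + g·vvᵀ` (`dJ = det J`, `mu = m(J,u)`, `mv = m(J,v)`, `D2 = (u₀v₁ − u₁v₀)²`), `f, g ≠ 0` of non-negative
coefficients; WEAK HARD CELL: `dJ ≤ 0`, `mu ≤ 0`, `mv ≤ 0` (the open cell of the `m = 2` rows; off it Descartes already gives
`2K`, tree `…CensusPivotTwoCore` / `…PivotTwoDefinitePivot`), `D2 > 0` (`u ∦ v`).
* `negSupp_neg_subset_sumset`: a POSITIVE coefficient of `Φ` sits at a degree of the SUMSET `supp f + supp g`.
* `trailingCoeff_of_both_low` / `leadingCoeff_of_both_high`: if both `f` and `g` have a term below the pivot exponent `e`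
  (`natTrailingDegree < e`), the lowest coefficient of `Φ` is `D2·tc(f)·tc(g) > 0`; mirror statement at the top.
* **`posRoots_add_ends_le_two_mul_card_sumset`** (the count): `Z₊(Φ) + [tdeg f < e ∧ tdeg g < e] + [e < deg f ∧ e < deg g]
  ≤ 2·#(supp f + supp g)` (two-ended budget `Census.signVariations_two_ended_le` applied to `−Φ`).
COROLLARIES (all `K`, all exponents).
* **`posRoots_le_of_lone_letter`**: `f = a·X^p` a single `u`-letter with `p < e` and some `v`-letter below `e` (or the mirror):
  `Z₊ ≤ 2·#supp g − 1`.  In particular a LONE FULL-RANK LETTER `X^p(a uuᵀ + b vvᵀ)` (`p ≠ e`) against `v`-parallel null letters: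
  **`Z₊ ≤ 2K − 1`** (`K = #supp g` = number of distinct exponents; matrix form `det_posRoots_le_of_lone_fullRank`) — between the
  tree's `2K − 2` for a lone NULL letter (`TwoDirections.posRoots_le_of_one_against_parallel`) and the conjectured row `2K`; the
  pole-weaving `2K`-witnesses of `…PivotStaircaseAllK` (val-sym-mdr-p2 g24: below letter `diag(1,1/32)`, above letters
  `diag(ε, 8nᵢ)`) are NOT of this shape exactly because `ε > 0`: with `ε = 0` they cap at `2K − 1` (the slack is necessary).
* **`posRoots_add_two_le_of_both_straddle`**: if BOTH directions carry letters on both sides of the pivot, `Z₊ + 2 ≤ 2·#(supp f +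
  supp g) ≤ 2·K_u·K_v`; at `(K_u,K_v) = (2,2)` this is `Z₊ ≤ 6 = 2K − 2`, the BLOCK `(2,2)` bound in the doubly-straddling
  configurations left open by `…PivotTwoDirectionsBlockLawAll` (which settles the sign-separated ones).
Nothing here bears on `Theses.LacunarySymmetroid.MatrixDescartes` in its window, on `KPlusLogSqLaw`, on `DoorA26` / `DoorA34`,
on the cell's registers or credences, or on `VP ≠ VNP`.

[folklore] Descartes' rule of signs with a support budget and end corrections (Mathlib `Polynomial.signVariations`, tree
`Census.signVariations_two_ended_le`, `Census.card_posRoots_le_signVariations`, `TwoDirections.Ends.coeff_twoDirDet`,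
`TwoDirections.det_twoDir`).  No definitions, no named facts.
-/

-- `Summit.ValiantsHypothesis.ValiantsHypothesis.…` repeats a component by the D-0017 layout
-- (single-conjunct summit), which the `dupNamespace` linter flags; the name is mandated.
set_option linter.dupNamespace false

namespace Summit.ValiantsHypothesis.ValiantsHypothesis.Theorems.LacunarySymmetroidMatrixDescartes.Pivot.TwoDirections.PosEnds

open Polynomial Matrix Finset
open scoped BigOperators
open Ends (coeff_twoDirDet coeff_mul_eq_zero_of_no_split coeff_mul_nonneg_of_nonneg)

/-! ## 1. Positive coefficients live on the sumset `supp f + supp g` -/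

/-- A non-zero coefficient of `f·g` sits at a degree of the sumset `supp f + supp g` (the image of the product under addition).
[folklore] -/
theorem mem_sumset_of_coeff_mul_ne_zero (f g : ℝ[X]) (n : ℕ) (h : (f * g).coeff n ≠ 0) :
    n ∈ (f.support ×ˢ g.support).image (fun ij : ℕ × ℕ => ij.1 + ij.2) := by
  classical
  by_contra hn
  refine h (coeff_mul_eq_zero_of_no_split f g n fun i j hij => ?_)
  by_contra hne
  push Not at hne
  exact hn (Finset.mem_image.mpr ⟨(i, j), Finset.mem_product.mpr
    ⟨Polynomial.mem_support_iff.mpr hne.1, Polynomial.mem_support_iff.mpr hne.2⟩, hij⟩)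

/-- **Sign law for positive coefficients.**  In the weak hard cell (`dJ, mu, mv ≤ 0`), with `f, g` of non-negative
coefficients, every NEGATIVE coefficient of `−Φ` (= positive coefficient of `Φ`) sits at a degree of the sumset
`supp f + supp g`. [folklore] -/
theorem negSupp_neg_subset_sumset (e : ℕ) (f g : ℝ[X]) (dJ mu mv D2 : ℝ) (hf0 : ∀ i, 0 ≤ f.coeff i)
    (hg0 : ∀ j, 0 ≤ g.coeff j) (hdJ : dJ ≤ 0) (hmu : mu ≤ 0) (hmv : mv ≤ 0) :
    Pivot.TwoDescartes.negSupp (-((X : ℝ[X]) ^ (2 * e) * Polynomial.C dJ + (X : ℝ[X]) ^ e * f * Polynomial.C mu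
        + (X : ℝ[X]) ^ e * g * Polynomial.C mv + f * g * Polynomial.C D2))
      ⊆ (f.support ×ˢ g.support).image (fun ij : ℕ × ℕ => ij.1 + ij.2) := by
  classical
  intro n hn
  simp only [Pivot.TwoDescartes.negSupp, Finset.mem_filter, Polynomial.coeff_neg, neg_lt_zero] at hn
  have h := hn.2
  rw [coeff_twoDirDet] at h
  refine mem_sumset_of_coeff_mul_ne_zero f g n fun hzero => ?_
  have t1 : (if n = 2 * e then dJ else 0) ≤ 0 := by split_ifs <;> simp [hdJ]
  have t2 : mu * (if e ≤ n then f.coeff (n - e) else 0) ≤ 0 := by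
    split_ifs; exacts [mul_nonpos_of_nonpos_of_nonneg hmu (hf0 _), by simp]
  have t3 : mv * (if e ≤ n then g.coeff (n - e) else 0) ≤ 0 := by
    split_ifs; exacts [mul_nonpos_of_nonpos_of_nonneg hmv (hg0 _), by simp]
  rw [hzero, mul_zero] at h
  linarith

/-! ## 2. The two ends of the positive support -/

/-- **The lowest coefficient, both directions below the pivot.**  If `f, g ≠ 0` both have their trailing degree `< e`, the
lowest degree of `Φ` is `tdeg f + tdeg g` and its coefficient is `D2 · tc(f) · tc(g)`. [folklore] -/
theorem trailingCoeff_of_both_low (e : ℕ) (f g : ℝ[X]) (dJ mu mv D2 : ℝ) (hf : f ≠ 0) (hg : g ≠ 0)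
    (htf : f.natTrailingDegree < e) (htg : g.natTrailingDegree < e) (hD2 : D2 ≠ 0) :
    ((X : ℝ[X]) ^ (2 * e) * Polynomial.C dJ + (X : ℝ[X]) ^ e * f * Polynomial.C mu + (X : ℝ[X]) ^ e * g * Polynomial.C mv
        + f * g * Polynomial.C D2).trailingCoeff = D2 * (f.trailingCoeff * g.trailingCoeff) := by
  set Φ := (X : ℝ[X]) ^ (2 * e) * Polynomial.C dJ + (X : ℝ[X]) ^ e * f * Polynomial.C mu
    + (X : ℝ[X]) ^ e * g * Polynomial.C mv + f * g * Polynomial.C D2 with hΦ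
  set t := f.natTrailingDegree + g.natTrailingDegree with ht
  have hfg_deg : (f * g).natTrailingDegree = t := natTrailingDegree_mul hf hg
  have hfg_t : (f * g).coeff t = f.trailingCoeff * g.trailingCoeff := by
    rw [← hfg_deg]
    exact trailingCoeff_mul f g
  have hfg_low : ∀ m, m < t → (f * g).coeff m = 0 := fun m hm =>
    coeff_eq_zero_of_lt_natTrailingDegree (by rw [hfg_deg]; exact hm)
  have hcoef : Φ.coeff t = D2 * (f.trailingCoeff * g.trailingCoeff) := by
    rw [hΦ, coeff_twoDirDet, if_neg (by omega), hfg_t]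
    have h1 : (if e ≤ t then f.coeff (t - e) else 0) = 0 := by
      split_ifs with h; exacts [coeff_eq_zero_of_lt_natTrailingDegree (by omega), rfl]
    have h2 : (if e ≤ t then g.coeff (t - e) else 0) = 0 := by
      split_ifs with h; exacts [coeff_eq_zero_of_lt_natTrailingDegree (by omega), rfl]
    rw [h1, h2]; ring
  have hlow : ∀ m, m < t → Φ.coeff m = 0 := by
    intro m hm
    rw [hΦ, coeff_twoDirDet, if_neg (by omega), hfg_low m hm]
    have h1 : (if e ≤ m then f.coeff (m - e) else 0) = 0 := by
      split_ifs with h; exacts [coeff_eq_zero_of_lt_natTrailingDegree (by omega), rfl]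
    have h2 : (if e ≤ m then g.coeff (m - e) else 0) = 0 := by
      split_ifs with h; exacts [coeff_eq_zero_of_lt_natTrailingDegree (by omega), rfl]
    rw [h1, h2]; ring
  have hft : f.trailingCoeff ≠ 0 := mt trailingCoeff_eq_zero.mp hf
  have hgt : g.trailingCoeff ≠ 0 := mt trailingCoeff_eq_zero.mp hg
  have hnz : Φ.coeff t ≠ 0 := by rw [hcoef]; exact mul_ne_zero hD2 (mul_ne_zero hft hgt)
  have hne : Φ ≠ 0 := fun h0 => hnz (by rw [h0, coeff_zero])
  have h1 : Φ.natTrailingDegree ≤ t := natTrailingDegree_le_of_ne_zero hnz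
  have h2 : t ≤ Φ.natTrailingDegree := le_natTrailingDegree hne fun m hm => hlow m hm
  change Φ.coeff Φ.natTrailingDegree = _
  rw [le_antisymm h1 h2, hcoef]

/-- **The highest coefficient, both directions above the pivot.**  If `f, g ≠ 0` both have degree `> e`, the top degree of
`Φ` is `deg f + deg g` and its coefficient is `D2 · lc(f) · lc(g)`. [folklore] -/
theorem leadingCoeff_of_both_high (e : ℕ) (f g : ℝ[X]) (dJ mu mv D2 : ℝ) (hf : f ≠ 0) (hg : g ≠ 0)
    (hdf : e < f.natDegree) (hdg : e < g.natDegree) (hD2 : D2 ≠ 0) :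
    ((X : ℝ[X]) ^ (2 * e) * Polynomial.C dJ + (X : ℝ[X]) ^ e * f * Polynomial.C mu + (X : ℝ[X]) ^ e * g * Polynomial.C mv
        + f * g * Polynomial.C D2).leadingCoeff = D2 * (f.leadingCoeff * g.leadingCoeff) := by
  set Φ := (X : ℝ[X]) ^ (2 * e) * Polynomial.C dJ + (X : ℝ[X]) ^ e * f * Polynomial.C mu
    + (X : ℝ[X]) ^ e * g * Polynomial.C mv + f * g * Polynomial.C D2 with hΦ
  set T := f.natDegree + g.natDegree with hT
  have hfg_deg : (f * g).natDegree = T := natDegree_mul hf hg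
  have hfg_T : (f * g).coeff T = f.leadingCoeff * g.leadingCoeff := by
    rw [← hfg_deg]
    exact leadingCoeff_mul f g
  have hfg_high : ∀ m, T < m → (f * g).coeff m = 0 := fun m hm =>
    coeff_eq_zero_of_natDegree_lt (by rw [hfg_deg]; exact hm)
  have hcoef : Φ.coeff T = D2 * (f.leadingCoeff * g.leadingCoeff) := by
    rw [hΦ, coeff_twoDirDet, if_neg (by omega), hfg_T, if_pos (by omega), if_pos (by omega)]
    have h1 : f.coeff (T - e) = 0 := coeff_eq_zero_of_natDegree_lt (by omega)
    have h2 : g.coeff (T - e) = 0 := coeff_eq_zero_of_natDegree_lt (by omega)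
    rw [h1, h2]; ring
  have hhigh : ∀ m, T < m → Φ.coeff m = 0 := by
    intro m hm
    rw [hΦ, coeff_twoDirDet, if_neg (by omega), hfg_high m hm, if_pos (by omega), if_pos (by omega)]
    have h1 : f.coeff (m - e) = 0 := coeff_eq_zero_of_natDegree_lt (by omega)
    have h2 : g.coeff (m - e) = 0 := coeff_eq_zero_of_natDegree_lt (by omega)
    rw [h1, h2]; ring
  have hfl : f.leadingCoeff ≠ 0 := mt leadingCoeff_eq_zero.mp hf
  have hgl : g.leadingCoeff ≠ 0 := mt leadingCoeff_eq_zero.mp hg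
  have hnz : Φ.coeff T ≠ 0 := by rw [hcoef]; exact mul_ne_zero hD2 (mul_ne_zero hfl hgl)
  have hle : Φ.natDegree ≤ T := by
    refine natDegree_le_iff_coeff_eq_zero.mpr fun m hm => hhigh m ?_
    exact_mod_cast hm
  have hdeg : Φ.natDegree = T := natDegree_eq_of_le_of_coeff_ne_zero hle hnz
  change Φ.coeff Φ.natDegree = _
  rw [hdeg, hcoef]

/-- `trailingCoeff (−P) = −trailingCoeff P`. [folklore] -/
theorem trailingCoeff_neg' (P : ℝ[X]) : (-P).trailingCoeff = -P.trailingCoeff := by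
  change (-P).coeff (-P).natTrailingDegree = -(P.coeff P.natTrailingDegree)
  rw [natTrailingDegree_neg, coeff_neg]

/-! ## 3. The count -/

/-- **THE POSITIVE-SUPPORT COUNT WITH ENDS** (every exponent configuration, weak hard cell `dJ, mu, mv ≤ 0`, `D2 > 0`,
`f, g ≠ 0` of non-negative coefficients):
`Z₊(Φ) + [tdeg f < e ∧ tdeg g < e] + [e < deg f ∧ e < deg g] ≤ 2 · #(supp f + supp g)`.
Proof: Descartes (`Z₊ ≤ Var`), `Var(−Φ) + [lc(−Φ) < 0] + [tc(−Φ) < 0] ≤ 2·#negSupp(−Φ)` (tree, two-ended budget), the negative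
support of `−Φ` lies in the sumset, and each end condition makes the corresponding end coefficient of `Φ` positive. [this file] -/
theorem posRoots_add_ends_le_two_mul_card_sumset (e : ℕ) (f g : ℝ[X]) (dJ mu mv D2 : ℝ) (hf : f ≠ 0) (hg : g ≠ 0)
    (hf0 : ∀ i, 0 ≤ f.coeff i) (hg0 : ∀ j, 0 ≤ g.coeff j) (hdJ : dJ ≤ 0) (hmu : mu ≤ 0) (hmv : mv ≤ 0) (hD2 : 0 < D2) :
    ((((X : ℝ[X]) ^ (2 * e) * Polynomial.C dJ + (X : ℝ[X]) ^ e * f * Polynomial.C mu + (X : ℝ[X]) ^ e * g * Polynomial.C mv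
        + f * g * Polynomial.C D2).roots.toFinset.filter (fun t => 0 < t)).card)
      + (if f.natTrailingDegree < e ∧ g.natTrailingDegree < e then 1 else 0)
      + (if e < f.natDegree ∧ e < g.natDegree then 1 else 0)
      ≤ 2 * ((f.support ×ˢ g.support).image (fun ij : ℕ × ℕ => ij.1 + ij.2)).card := by
  classical
  set Φ := (X : ℝ[X]) ^ (2 * e) * Polynomial.C dJ + (X : ℝ[X]) ^ e * f * Polynomial.C mu
    + (X : ℝ[X]) ^ e * g * Polynomial.C mv + f * g * Polynomial.C D2 with hΦ
  set S := (f.support ×ˢ g.support).image (fun ij : ℕ × ℕ => ij.1 + ij.2) with hS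
  have hft : 0 < f.trailingCoeff := lt_of_le_of_ne (hf0 _) (Ne.symm (mt trailingCoeff_eq_zero.mp hf))
  have hgt : 0 < g.trailingCoeff := lt_of_le_of_ne (hg0 _) (Ne.symm (mt trailingCoeff_eq_zero.mp hg))
  have hfl : 0 < f.leadingCoeff := lt_of_le_of_ne (hf0 _) (Ne.symm (mt leadingCoeff_eq_zero.mp hf))
  have hgl : 0 < g.leadingCoeff := lt_of_le_of_ne (hg0 _) (Ne.symm (mt leadingCoeff_eq_zero.mp hg))
  -- the two end conditions make the end coefficients of `−Φ` negative
  have hT : (f.natTrailingDegree < e ∧ g.natTrailingDegree < e) → (-Φ).trailingCoeff < 0 := by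
    rintro ⟨h1, h2⟩
    rw [trailingCoeff_neg', hΦ, trailingCoeff_of_both_low e f g dJ mu mv D2 hf hg h1 h2 hD2.ne', neg_lt_zero]
    positivity
  have hL : (e < f.natDegree ∧ e < g.natDegree) → (-Φ).leadingCoeff < 0 := by
    rintro ⟨h1, h2⟩
    rw [leadingCoeff_neg, hΦ, leadingCoeff_of_both_high e f g dJ mu mv D2 hf hg h1 h2 hD2.ne', neg_lt_zero]
    positivity
  have key := Census.signVariations_two_ended_le (-Φ)
  have hZ := Census.card_posRoots_le_signVariations (-Φ)
  rw [Polynomial.roots_neg] at hZ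
  have hsub : Pivot.TwoDescartes.negSupp (-Φ) ⊆ S := negSupp_neg_subset_sumset e f g dJ mu mv D2 hf0 hg0 hdJ hmu hmv
  have hcard := Finset.card_le_card hsub
  have iT : (if f.natTrailingDegree < e ∧ g.natTrailingDegree < e then 1 else 0)
      ≤ (if (-Φ).trailingCoeff < 0 then 1 else 0) := by
    by_cases h1 : f.natTrailingDegree < e ∧ g.natTrailingDegree < e
    · rw [if_pos h1, if_pos (hT h1)]
    · rw [if_neg h1]; exact Nat.zero_le _
  have iL : (if e < f.natDegree ∧ e < g.natDegree then 1 else 0) ≤ (if (-Φ).leadingCoeff < 0 then 1 else 0) := by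
    by_cases h1 : e < f.natDegree ∧ e < g.natDegree
    · rw [if_pos h1, if_pos (hL h1)]
    · rw [if_neg h1]; exact Nat.zero_le _
  omega

/-! ## 4. Corollaries -/

/-- The sumset has at most `#supp f · #supp g` elements. -/
theorem card_sumset_le (f g : ℝ[X]) :
    ((f.support ×ˢ g.support).image (fun ij : ℕ × ℕ => ij.1 + ij.2)).card ≤ f.support.card * g.support.card :=
  Finset.card_image_le.trans (Finset.card_product _ _).le

/-- For a monomial `f = a X^p` (`a ≠ 0`) the sumset is a translate of `supp g`: it has `#supp g` elements. -/
theorem card_sumset_monomial (a : ℝ) (ha : a ≠ 0) (p : ℕ) (g : ℝ[X]) :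
    (((Polynomial.C a * X ^ p).support ×ˢ g.support).image (fun ij : ℕ × ℕ => ij.1 + ij.2)).card = g.support.card := by
  classical
  rw [Polynomial.support_C_mul_X_pow p ha, Finset.singleton_product, Finset.map_eq_image, Finset.image_image]
  refine Finset.card_image_of_injective _ fun j j' h => ?_
  simpa using h

/-- Trailing degree and degree of a monomial `a X^p`, `a ≠ 0`. [folklore] -/
theorem natTrailingDegree_C_mul_X_pow' (a : ℝ) (ha : a ≠ 0) (p : ℕ) :
    (Polynomial.C a * X ^ p).natTrailingDegree = p ∧ (Polynomial.C a * X ^ p).natDegree = p := by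
  refine ⟨?_, natDegree_C_mul_X_pow p a ha⟩
  rw [Polynomial.C_mul_X_pow_eq_monomial]
  exact natTrailingDegree_monomial ha

/-- **A LONE `u`-LETTER: `Z₊ ≤ 2·#supp g − 1`.**  `f = a·X^p` (`a > 0`) and the lone letter has a `v`-letter on its own side
of the pivot (`p < e` and `tdeg g < e`, or `e < p` and `e < deg g`); weak hard cell, `D2 > 0`, `g ≠ 0` of non-negative
coefficients. [this file] -/
theorem posRoots_le_of_lone_letter (e p : ℕ) (a : ℝ) (g : ℝ[X]) (dJ mu mv D2 : ℝ) (ha : 0 < a) (hg : g ≠ 0)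
    (hg0 : ∀ j, 0 ≤ g.coeff j) (hdJ : dJ ≤ 0) (hmu : mu ≤ 0) (hmv : mv ≤ 0) (hD2 : 0 < D2)
    (hside : (p < e ∧ g.natTrailingDegree < e) ∨ (e < p ∧ e < g.natDegree)) :
    ((((X : ℝ[X]) ^ (2 * e) * Polynomial.C dJ + (X : ℝ[X]) ^ e * (Polynomial.C a * X ^ p) * Polynomial.C mu
        + (X : ℝ[X]) ^ e * g * Polynomial.C mv + (Polynomial.C a * X ^ p) * g * Polynomial.C D2).roots.toFinset.filter
          (fun t => 0 < t)).card) + 1 ≤ 2 * g.support.card := by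
  have hf : (Polynomial.C a * X ^ p : ℝ[X]) ≠ 0 := by
    intro h; have := congrArg (fun q : ℝ[X] => q.coeff p) h
    simp at this; exact ha.ne' this
  have hf0 : ∀ i, 0 ≤ (Polynomial.C a * X ^ p : ℝ[X]).coeff i := by
    intro i; rw [Polynomial.coeff_C_mul_X_pow]; split_ifs <;> [exact ha.le; exact le_rfl]
  have h := posRoots_add_ends_le_two_mul_card_sumset e (Polynomial.C a * X ^ p) g dJ mu mv D2 hf hg hf0 hg0 hdJ hmu hmv hD2
  rw [card_sumset_monomial a ha.ne' p g] at h
  obtain ⟨htd, hd⟩ := natTrailingDegree_C_mul_X_pow' a ha.ne' p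
  rw [htd, hd] at h
  rcases hside with ⟨h1, h2⟩ | ⟨h1, h2⟩
  · rw [if_pos ⟨h1, h2⟩] at h; omega
  · rw [if_neg (fun h' : p < e ∧ g.natTrailingDegree < e => absurd h'.1 (by omega)), if_pos ⟨h1, h2⟩] at h; omega

/-- **BOTH DIRECTIONS STRADDLE THE PIVOT: `Z₊ + 2 ≤ 2·#(supp f + supp g) ≤ 2·#supp f·#supp g`.**  If each of `f`, `g` has a term
below and a term above the pivot exponent `e` (weak hard cell, `D2 > 0`), both end coefficients of `Φ` are positive.  At
`(#supp f, #supp g) = (2,2)`: `Z₊ ≤ 6`. [this file] -/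
theorem posRoots_add_two_le_of_both_straddle (e : ℕ) (f g : ℝ[X]) (dJ mu mv D2 : ℝ) (hf : f ≠ 0) (hg : g ≠ 0)
    (hf0 : ∀ i, 0 ≤ f.coeff i) (hg0 : ∀ j, 0 ≤ g.coeff j) (hdJ : dJ ≤ 0) (hmu : mu ≤ 0) (hmv : mv ≤ 0) (hD2 : 0 < D2)
    (hfs : f.natTrailingDegree < e ∧ e < f.natDegree) (hgs : g.natTrailingDegree < e ∧ e < g.natDegree) :
    ((((X : ℝ[X]) ^ (2 * e) * Polynomial.C dJ + (X : ℝ[X]) ^ e * f * Polynomial.C mu + (X : ℝ[X]) ^ e * g * Polynomial.C mv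
        + f * g * Polynomial.C D2).roots.toFinset.filter (fun t => 0 < t)).card) + 2
      ≤ 2 * (f.support.card * g.support.card) := by
  have h := posRoots_add_ends_le_two_mul_card_sumset e f g dJ mu mv D2 hf hg hf0 hg0 hdJ hmu hmv hD2
  rw [if_pos ⟨hfs.1, hgs.1⟩, if_pos ⟨hfs.2, hgs.2⟩] at h
  have hc := card_sumset_le f g
  omega

/-! ## 5. Matrix forms -/

/-- **Matrix form of the count.**  `F = X^e J + f·uuᵀ + g·vvᵀ`, `f, g ≠ 0` of non-negative coefficients, `u ∦ v`, weak hard cell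
(`det J ≤ 0`, `m(J,u) ≤ 0`, `m(J,v) ≤ 0`):
`Z₊ + [tdeg f < e ∧ tdeg g < e] + [e < deg f ∧ e < deg g] ≤ 2·#(supp f + supp g)`. [this file] -/
theorem det_posRoots_add_ends_le (e : ℕ) (J : Matrix (Fin 2) (Fin 2) ℝ) (u v : Fin 2 → ℝ) (f g : ℝ[X]) (hf : f ≠ 0)
    (hg : g ≠ 0) (hf0 : ∀ i, 0 ≤ f.coeff i) (hg0 : ∀ j, 0 ≤ g.coeff j) (hΔ : u 0 * v 1 - u 1 * v 0 ≠ 0) (hJ : J.det ≤ 0)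
    (hmu : J 0 0 * u 1 ^ 2 + J 1 1 * u 0 ^ 2 - (J 0 1 + J 1 0) * (u 0 * u 1) ≤ 0)
    (hmv : J 0 0 * v 1 ^ 2 + J 1 1 * v 0 ^ 2 - (J 0 1 + J 1 0) * (v 0 * v 1) ≤ 0) :
    ((Matrix.det (((X : ℝ[X]) ^ e) • J.map Polynomial.C + f • (vecMulVec u u).map Polynomial.C
        + g • (vecMulVec v v).map Polynomial.C)).roots.toFinset.filter (fun t => 0 < t)).card
      + (if f.natTrailingDegree < e ∧ g.natTrailingDegree < e then 1 else 0)
      + (if e < f.natDegree ∧ e < g.natDegree then 1 else 0)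
      ≤ 2 * ((f.support ×ˢ g.support).image (fun ij : ℕ × ℕ => ij.1 + ij.2)).card := by
  rw [det_twoDir]
  exact posRoots_add_ends_le_two_mul_card_sumset e f g J.det _ _ _ hf hg hf0 hg0 hJ hmu hmv (by positivity)

/-- **A LONE FULL-RANK LETTER AGAINST PARALLEL NULL LETTERS: `Z₊ ≤ 2K − 1`.**  `F = X^e J + X^p·(a uuᵀ + b vvᵀ) + h·vvᵀ` written as
`X^e J + (aX^p)·uuᵀ + (bX^p + h)·vvᵀ`, with `a, b > 0`, `u ∦ v`, `p ≠ e`, `h` of non-negative coefficients (the `v`-parallel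
null letters), weak hard cell: with `g = b X^p + h` the `v`-posynomial (`K := #supp g` distinct exponents = the number of letters),
`Z₊ + 1 ≤ 2K`. [this file] -/
theorem det_posRoots_le_of_lone_fullRank (e p : ℕ) (J : Matrix (Fin 2) (Fin 2) ℝ) (u v : Fin 2 → ℝ) (a b : ℝ) (h : ℝ[X])
    (ha : 0 < a) (hb : 0 < b) (hh0 : ∀ j, 0 ≤ h.coeff j) (hpe : p ≠ e) (hΔ : u 0 * v 1 - u 1 * v 0 ≠ 0) (hJ : J.det ≤ 0)
    (hmu : J 0 0 * u 1 ^ 2 + J 1 1 * u 0 ^ 2 - (J 0 1 + J 1 0) * (u 0 * u 1) ≤ 0)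
    (hmv : J 0 0 * v 1 ^ 2 + J 1 1 * v 0 ^ 2 - (J 0 1 + J 1 0) * (v 0 * v 1) ≤ 0) :
    ((Matrix.det (((X : ℝ[X]) ^ e) • J.map Polynomial.C
        + (Polynomial.C a * X ^ p) • (vecMulVec u u).map Polynomial.C
        + (Polynomial.C b * X ^ p + h) • (vecMulVec v v).map Polynomial.C)).roots.toFinset.filter (fun t => 0 < t)).card + 1
      ≤ 2 * (Polynomial.C b * X ^ p + h).support.card := by
  set g : ℝ[X] := Polynomial.C b * X ^ p + h with hgdef
  have hgp : g.coeff p = b + h.coeff p := by rw [hgdef, coeff_add, Polynomial.coeff_C_mul_X_pow, if_pos rfl]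
  have hgp_pos : 0 < g.coeff p := by rw [hgp]; linarith [hh0 p]
  have hg : g ≠ 0 := fun h0 => by rw [h0, coeff_zero] at hgp_pos; exact lt_irrefl _ hgp_pos
  have hg0 : ∀ j, 0 ≤ g.coeff j := by
    intro j; rw [hgdef, coeff_add, Polynomial.coeff_C_mul_X_pow]
    split_ifs <;> linarith [hh0 j, hb.le]
  have htd : g.natTrailingDegree ≤ p := natTrailingDegree_le_of_ne_zero hgp_pos.ne'
  have hd : p ≤ g.natDegree := le_natDegree_of_ne_zero hgp_pos.ne'
  have hside : (p < e ∧ g.natTrailingDegree < e) ∨ (e < p ∧ e < g.natDegree) := by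
    rcases lt_or_gt_of_ne hpe with hp | hp
    · exact Or.inl ⟨hp, lt_of_le_of_lt htd hp⟩
    · exact Or.inr ⟨hp, lt_of_lt_of_le hp hd⟩
  rw [det_twoDir]
  exact posRoots_le_of_lone_letter e p a g J.det _ _ _ ha hg hg0 hJ hmu hmv (by positivity) hside

/-! ## 6. Pivot currency: the lone-full-rank-letter family -/

variable {K : ℕ}

/-- The letter sum of the family «letter `k₀` is `a·uuᵀ + b·vvᵀ`, every other letter is `cₖ·vvᵀ`» collapses to the
two-direction form `(aX^{d k₀})·uuᵀ + (bX^{d k₀} + h)·vvᵀ`, `h = ∑_{k ≠ k₀} cₖ X^{dₖ}`. [bookkeeping] -/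
theorem letters_eq_lone_fullRank (d : Fin K → ℕ) (u v : Fin 2 → ℝ) (k₀ : Fin K) (a b : ℝ) (c : Fin K → ℝ)
    (P : Fin K → Matrix (Fin 2) (Fin 2) ℝ) (hP0 : P k₀ = a • vecMulVec u u + b • vecMulVec v v)
    (hP : ∀ k, k ≠ k₀ → P k = c k • vecMulVec v v) :
    ∑ k, ((X : ℝ[X]) ^ d k) • (P k).map Polynomial.C
      = (Polynomial.C a * X ^ d k₀) • (vecMulVec u u).map Polynomial.C
        + (Polynomial.C b * X ^ d k₀ + ∑ k ∈ univ.erase k₀, Polynomial.C (c k) * X ^ d k)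
            • (vecMulVec v v).map Polynomial.C := by
  classical
  rw [← Finset.add_sum_erase univ _ (Finset.mem_univ k₀), hP0, add_smul, Finset.sum_smul]
  have hterm : ∀ k ∈ univ.erase k₀, ((X : ℝ[X]) ^ d k) • (P k).map Polynomial.C
      = (Polynomial.C (c k) * X ^ d k) • (vecMulVec v v).map Polynomial.C := by
    intro k hk
    rw [hP k (Finset.ne_of_mem_erase hk)]
    ext i j
    simp only [Matrix.smul_apply, Matrix.map_apply, smul_eq_mul, map_mul]
    ring
  rw [Finset.sum_congr rfl hterm, ← add_assoc]
  congr 1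
  ext i j
  simp only [Matrix.add_apply, Matrix.smul_apply, Matrix.map_apply, smul_eq_mul, map_mul, map_add]
  ring

/-- The `v`-posynomial of the family has at most `K` monomials (its support lies in the image of `d`). [bookkeeping] -/
theorem card_support_vPoly_le (d : Fin K → ℕ) (k₀ : Fin K) (b : ℝ) (c : Fin K → ℝ) :
    (Polynomial.C b * X ^ d k₀ + ∑ k ∈ univ.erase k₀, Polynomial.C (c k) * X ^ d k).support.card ≤ K := by
  classical
  have hsub : (Polynomial.C b * X ^ d k₀ + ∑ k ∈ univ.erase k₀, Polynomial.C (c k) * X ^ d k).support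
      ⊆ Finset.univ.image d := by
    intro n hn
    rw [Polynomial.mem_support_iff, coeff_add, Polynomial.coeff_C_mul_X_pow, finsetSum_coeff] at hn
    by_contra hnot
    have h1 : (if n = d k₀ then b else 0) = 0 := if_neg fun h => hnot (Finset.mem_image.mpr ⟨k₀, Finset.mem_univ _, h.symm⟩)
    have h2 : ∑ k ∈ univ.erase k₀, (Polynomial.C (c k) * X ^ d k).coeff n = 0 := by
      refine Finset.sum_eq_zero fun k _ => ?_
      rw [Polynomial.coeff_C_mul_X_pow, if_neg]
      exact fun h => hnot (Finset.mem_image.mpr ⟨k, Finset.mem_univ _, h.symm⟩)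
    exact hn (by rw [h1, h2, add_zero])
  refine (Finset.card_le_card hsub).trans (Finset.card_image_le.trans ?_)
  simp

/-- **PIVOT CURRENCY: A LONE FULL-RANK LETTER AGAINST PARALLEL NULL LETTERS HAS `Z₊ ≤ 2K − 1`** (every `K`, every exponents with
the full-rank letter off the pivot exponent, weak hard cell `det J ≤ 0`, `m(J,u) ≤ 0`, `m(J,v) ≤ 0`; no index hypothesis is used and the
letters are automatically PSD).  Letter `k₀` is `a·uuᵀ + b·vvᵀ` (`a, b > 0`, `u ∦ v`: ANY positive definite `2 × 2` matrix has this form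
for any prescribed `v`), every other letter is `cₖ·vvᵀ` (`cₖ ≥ 0`): `pivotPosRoots e d J P + 1 ≤ 2K`. [this file] -/
theorem pivotPosRoots_le_of_lone_fullRank (e : ℕ) (d : Fin K → ℕ) (J : Matrix (Fin 2) (Fin 2) ℝ) (u v : Fin 2 → ℝ)
    (k₀ : Fin K) (a b : ℝ) (c : Fin K → ℝ) (ha : 0 < a) (hb : 0 < b) (hc : ∀ k, 0 ≤ c k)
    (P : Fin K → Matrix (Fin 2) (Fin 2) ℝ) (hP0 : P k₀ = a • vecMulVec u u + b • vecMulVec v v)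
    (hP : ∀ k, k ≠ k₀ → P k = c k • vecMulVec v v) (hde : d k₀ ≠ e) (hΔ : u 0 * v 1 - u 1 * v 0 ≠ 0) (hJ : J.det ≤ 0)
    (hmu : J 0 0 * u 1 ^ 2 + J 1 1 * u 0 ^ 2 - (J 0 1 + J 1 0) * (u 0 * u 1) ≤ 0)
    (hmv : J 0 0 * v 1 ^ 2 + J 1 1 * v 0 ^ 2 - (J 0 1 + J 1 0) * (v 0 * v 1) ≤ 0) :
    pivotPosRoots e d J P + 1 ≤ 2 * K := by
  classical
  unfold pivotPosRoots
  rw [letters_eq_lone_fullRank d u v k₀ a b c P hP0 hP, ← add_assoc]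
  have hh0 : ∀ j, 0 ≤ (∑ k ∈ univ.erase k₀, Polynomial.C (c k) * (X : ℝ[X]) ^ d k).coeff j := by
    intro j
    rw [finsetSum_coeff]
    refine Finset.sum_nonneg fun k _ => ?_
    rw [Polynomial.coeff_C_mul_X_pow]
    split_ifs
    · exact hc k
    · exact le_rfl
  have h := det_posRoots_le_of_lone_fullRank e (d k₀) J u v a b _ ha hb hh0 hde hΔ hJ hmu hmv
  have hK := card_support_vPoly_le d k₀ b c
  omega

end Summit.ValiantsHypothesis.ValiantsHypothesis.Theorems.LacunarySymmetroidMatrixDescartes.Pivot.TwoDirections.PosEnds
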